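import Summits.QuantumFields.YangMills.Theorems.BalabanUVNodesPortS1Sect4WTReductionAtRecord

/-!
# NODE O port, row PT-A-2 S4 — THE §4 WARD PACKAGE FOR AN ARBITRARY `SU(2)`-GAUGE-INVARIANT UNIT-LATTICE FUNCTIONAL (generic over the functional, the lattice and the shifts):
# (4.15)₂, (4.15)₃, the p. 289 `Ad`-invariance, (4.29) EXACT, (4.31) EXACT and the (4.32)–(4.34) scalar-kernel form of the Hessian, for `f = expChart ℰ ρ` with `ρ` ANY injective
# real-linear chart of `𝔰𝔲(2)` and `ℰ` ANY functional of `M₂(ℂ)`-valued bond fields that is gauge invariant on `SU(2)`-valued fields near `1` — the record (`ℰ := 𝓝_{k+1}`, FILES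
# `…Sect4WardSecondAtRecord ∕ …Sect4WTReductionAtRecord`) is ONE instance; the □₀-LOCALIZED piece functional `B ↦ 𝐄^{(j)}(X, U_j(□₀, exp iB))` of (4.2) p. 281, on which print's
# (4.21)–(4.34) actually operate, will be ANOTHER (its objects are PTA-1's (T1)∕S2-A); this file is the template both call

CITATION HEADER.  [I] = [Balaban1987RG1]: (4.2) p. 281, (4.7) p. 282, (4.15) p. 284, (4.21)–(4.31) pp. 285–289, (4.32)–(4.34) p. 289; [Hall2015] §1.2.2 (quaternions), Example 7.3.  Porter
PT-A-2 (`ymgap-nodeO-port-PTA-2`), `--supports stmt-QuantumFields-27930 --as helper`.  REUSED BY NAME: `…Sect4AmbientExtension.exists_ambient_extension` (generic quaternionic retraction),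
`B12WardSecond415.{third_chart_apply_grad_eq_zero_of_isSemisimple, hessian_chart_ad_invariant_of_isSemisimple}`, `B12WardThird415.fourth_chart_apply_grad_eq_zero_of_bracket`,
`B12WTReduction429.{eq429_chart_of_isSemisimple, eq431_chart_of_isSemisimple}`, `B12Schur433.{hessian_chart_eq_sum_scalar_kernel_killing, exists_eq_smul_of_centroid_of_killing_neg}`,
`SpecialUnitarySimple.isSimple_su`, `CompactKillingForm.{killingForm_su_apply_self_neg, instIsSemisimpleSu}`.
HYPOTHESES (all displayed, print's): `ρ : V →L[ℝ] M₂(ℂ)` injective onto `{X : Xᴴ = −X, tr X = 0}` (`hinj`, `hmem`, `honto`); `ℰ : (Λ → T → M₂(ℂ)) → F`; shifts `e : Λ → T` (the bond `(x, x + e ν)`);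
`C³`∕`C⁴` of `expChart ℰ ρ` at `0`; `hGI` = «`ℰ(V^g) = ℰ(V)` for `SU(2)`-valued `V` near `1` and `SU(2)`-valued `g`» (print's G-valued (4.7); p. 283: the `G^c`-invariance «is implied by
the invariance with respect to G-valued transformations, and by the analyticity»).
WHAT IS PROVED (0 sorry, 0 def): `exists_lieEquiv_su_of_suChart` (generic `eV : V ≃ₗ 𝔰𝔲(2)` with `↑(eV a) = ρ a` and the bracket law), ★ `wardSecond_of_suGaugeInvariant` ((4.15)₂),
★ `hessian_ad_invariant_of_suGaugeInvariant` (p. 289), ★ `wardThird_of_suGaugeInvariant` ((4.15)₃), ★★ `eq429_of_suGaugeInvariant` ((4.29) EXACT, 11 remainder terms), ★★ `eq431_of_suGaugeInvariant`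
((4.31) EXACT, 6 remainder terms), ★ `hessian_eq_sum_scalar_kernel_of_suGaugeInvariant` ((4.32)–(4.34) lineage form, ONE scalar kernel).
HONEST FRAMING.  A generic re-packaging of the lineage's kernel-checked algebra behind the quaternionic retraction; nothing of Bałaban's estimates asserted, ported or discharged; no bound,
no irrelevance; 27930 signed-open (⁸-Ax-LR4), no claim held; finite 𝕋⁴ at fixed ε — NOT continuum∕OS∕Clay; the Yang–Mills mass gap is NOT proved by any of this.
-/

noncomputable section

open scoped Matrix.Norms.L2Operator Topology

namespace Summit.QuantumFields.YangMills.Theorems.BalabanUVNodesPortS1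

open Filter Matrix
open NormedSpace (exp)
open Literature.Algebra.Lie.CompactKillingForm (su mem_su_iff)
open Literature.MathematicalPhysics.QuantumFieldTheory.Balaban1983to89
open Literature.MathematicalPhysics.QuantumFieldTheory.Balaban1983to89.B12PolarizationTensor120 (expChart expChart_apply)
open Literature.MathematicalPhysics.QuantumFieldTheory.Balaban1983to89.B12WardSecond415 (third_chart_apply_grad_eq_zero_of_isSemisimple hessian_chart_ad_invariant_of_isSemisimple)
open Literature.MathematicalPhysics.QuantumFieldTheory.Balaban1983to89.B12WardThird415 (fourth_chart_apply_grad_eq_zero_of_bracket)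
open Literature.MathematicalPhysics.QuantumFieldTheory.Balaban1983to89.B12WTReduction429 (eq429_chart_of_isSemisimple eq431_chart_of_isSemisimple)

section Generic

variable {V : Type*} [NormedAddCommGroup V] [NormedSpace ℝ V] {Λ T : Type*} [Fintype Λ] [Fintype T] [AddCommGroup T]
  {F : Type*} [NormedAddCommGroup F] [NormedSpace ℝ F]

/-- **A chart of 𝔰𝔲(2) IS 𝔰𝔲(2)**: for a real-linear injection `ρ : V → M₂(ℂ)` onto the traceless skew-Hermitian matrices there is a linear equivalence `eV : V ≃ 𝔰𝔲(2)` with `↑(eV a) = ρ a`;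
consequently `ρ(eV⁻¹⁅eV a, eV b⁆) = ρa ρb − ρb ρa`. [cite: Balaban1987RG1, p.252, p.264 (before (1.20)); Hall2015, Example 7.3] -/
theorem exists_lieEquiv_su_of_suChart (ρ : V →L[ℝ] Matrix (Fin 2) (Fin 2) ℂ) (hinj : Function.Injective ρ)
    (hmem : ∀ x, (ρ x)ᴴ = -ρ x ∧ (ρ x).trace = 0) (honto : ∀ X : Matrix (Fin 2) (Fin 2) ℂ, Xᴴ = -X → X.trace = 0 → ∃ x, ρ x = X) :
    ∃ eV : V ≃ₗ[ℝ] su (Fin 2), (∀ a, ((eV a : su (Fin 2)) : Matrix (Fin 2) (Fin 2) ℂ) = ρ a) ∧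
      ∀ a b : V, ρ (eV.symm ⁅eV a, eV b⁆) = ρ a * ρ b - ρ b * ρ a := by
  have hmem' : ∀ x : V, ρ x ∈ su (Fin 2) := fun x => mem_su_iff.2 (hmem x)
  let f : V →ₗ[ℝ] su (Fin 2) :=
    { toFun := fun x => ⟨ρ x, hmem' x⟩
      map_add' := fun x y => Subtype.ext (by simp only [map_add]; rfl)
      map_smul' := fun c x => Subtype.ext (by simp only [map_smul, RingHom.id_apply]; rfl) }
  have hf : ∀ x, ((f x : su (Fin 2)) : Matrix (Fin 2) (Fin 2) ℂ) = ρ x := fun _ => rfl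
  have hfinj : Function.Injective f := fun x y hxy => hinj (by rw [← hf, ← hf, hxy])
  have hfsurj : Function.Surjective f := fun X => by
    obtain ⟨h1, h2⟩ := mem_su_iff.1 X.2
    obtain ⟨x, hx⟩ := honto (X : Matrix (Fin 2) (Fin 2) ℂ) h1 h2
    exact ⟨x, Subtype.ext (by rw [hf]; exact hx)⟩
  let eV : V ≃ₗ[ℝ] su (Fin 2) := LinearEquiv.ofBijective f ⟨hfinj, hfsurj⟩
  have heV : ∀ a, ((eV a : su (Fin 2)) : Matrix (Fin 2) (Fin 2) ℂ) = ρ a := fun _ => rfl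
  refine ⟨eV, heV, fun a b => ?_⟩
  have h : ρ (eV.symm ⁅eV a, eV b⁆) = (((eV (eV.symm ⁅eV a, eV b⁆)) : su (Fin 2)) : Matrix (Fin 2) (Fin 2) ℂ) := (heV _).symm
  rw [h, LinearEquiv.apply_symm_apply]
  show ((eV a : su (Fin 2)) : Matrix (Fin 2) (Fin 2) ℂ) * ((eV b : su (Fin 2)) : Matrix (Fin 2) (Fin 2) ℂ) -
      ((eV b : su (Fin 2)) : Matrix (Fin 2) (Fin 2) ℂ) * ((eV a : su (Fin 2)) : Matrix (Fin 2) (Fin 2) ℂ) = _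
  rw [heV, heV]

/-- **★ (4.15)₂ FOR ANY `SU(2)`-GAUGE-INVARIANT FUNCTIONAL** `f = expChart ℰ ρ` (`C³` at `0`, `ℰ` invariant on `SU(2)`-valued fields near `1`): the second Ward–Takahashi identity at `B = 0`
with the brackets transported from 𝔰𝔲(2). [cite: Balaban1987RG1, (4.15) p.284, (4.11) p.283, (4.7) p.282] -/
theorem wardSecond_of_suGaugeInvariant (ρ : V →L[ℝ] Matrix (Fin 2) (Fin 2) ℂ) (hinj : Function.Injective ρ)
    (hmem : ∀ x, (ρ x)ᴴ = -ρ x ∧ (ρ x).trace = 0) (honto : ∀ X : Matrix (Fin 2) (Fin 2) ℂ, Xᴴ = -X → X.trace = 0 → ∃ x, ρ x = X)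
    (ℰ : (Λ → T → Matrix (Fin 2) (Fin 2) ℂ) → F) (e : Λ → T) (hC3 : ContDiffAt ℝ 3 (expChart ℰ ρ) 0)
    (hGI : ∀ᶠ Vf in 𝓝 (1 : Λ → T → Matrix (Fin 2) (Fin 2) ℂ), (∀ ν x, Vf ν x ∈ Matrix.specialUnitaryGroup (Fin 2) ℂ) →
      ∀ g : T → Matrix (Fin 2) (Fin 2) ℂ, (∀ x, g x ∈ Matrix.specialUnitaryGroup (Fin 2) ℂ) → ℰ (fun ν x => g x * Vf ν x * star (g (x + e ν))) = ℰ Vf) :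
    ∃ eV : V ≃ₗ[ℝ] su (Fin 2), (∀ a, ((eV a : su (Fin 2)) : Matrix (Fin 2) (Fin 2) ℂ) = ρ a) ∧
      ∀ (u w : Λ → T → V) (lam : T → V),
        fderiv ℝ (fderiv ℝ (fderiv ℝ (expChart ℰ ρ))) 0 u w (fun ν y => lam (y + e ν) - lam y)
          - fderiv ℝ (fderiv ℝ (expChart ℰ ρ)) 0 u
              (fun ν x => eV.symm ⁅eV (lam x), eV (w ν x)⁆ - (2 : ℝ)⁻¹ • eV.symm ⁅eV (w ν x), eV (lam (x + e ν) - lam x)⁆)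
          - fderiv ℝ (fderiv ℝ (expChart ℰ ρ)) 0 w
              (fun ν x => eV.symm ⁅eV (lam x), eV (u ν x)⁆ - (2 : ℝ)⁻¹ • eV.symm ⁅eV (u ν x), eV (lam (x + e ν) - lam x)⁆) = 0 := by
  obtain ⟨eV, heV, hρ⟩ := exists_lieEquiv_su_of_suChart ρ hinj hmem honto
  obtain ⟨ℰ', h1, h2, h3⟩ := exists_ambient_extension ρ hinj hmem honto ℰ e
  refine ⟨eV, heV, fun u w lam => ?_⟩
  have h := third_chart_apply_grad_eq_zero_of_isSemisimple eV e ρ hρ (h2 3 hC3)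
    (fun lam' => (h3 hGI lam').mono fun W hW => Filter.Eventually.of_forall fun t => hW t) u w lam
  have hchart : (fun B : Λ → T → V => ℰ' (fun ν x => exp (ρ (B ν x)))) = expChart ℰ ρ := by rw [← h1]; rfl
  rw [hchart] at h
  exact h

/-- **★ p. 289 `Ad`-invariance of the Hessian, infinitesimal form, FOR ANY `SU(2)`-GAUGE-INVARIANT FUNCTIONAL**: `D²f(0)(u, [l, w]) + D²f(0)(w, [l, u]) = 0`.
[cite: Balaban1987RG1, (4.32)-(4.33) p.289, (4.15) p.284] -/
theorem hessian_ad_invariant_of_suGaugeInvariant (ρ : V →L[ℝ] Matrix (Fin 2) (Fin 2) ℂ) (hinj : Function.Injective ρ)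
    (hmem : ∀ x, (ρ x)ᴴ = -ρ x ∧ (ρ x).trace = 0) (honto : ∀ X : Matrix (Fin 2) (Fin 2) ℂ, Xᴴ = -X → X.trace = 0 → ∃ x, ρ x = X)
    (ℰ : (Λ → T → Matrix (Fin 2) (Fin 2) ℂ) → F) (e : Λ → T) (hC3 : ContDiffAt ℝ 3 (expChart ℰ ρ) 0)
    (hGI : ∀ᶠ Vf in 𝓝 (1 : Λ → T → Matrix (Fin 2) (Fin 2) ℂ), (∀ ν x, Vf ν x ∈ Matrix.specialUnitaryGroup (Fin 2) ℂ) →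
      ∀ g : T → Matrix (Fin 2) (Fin 2) ℂ, (∀ x, g x ∈ Matrix.specialUnitaryGroup (Fin 2) ℂ) → ℰ (fun ν x => g x * Vf ν x * star (g (x + e ν))) = ℰ Vf) :
    ∃ eV : V ≃ₗ[ℝ] su (Fin 2), (∀ a, ((eV a : su (Fin 2)) : Matrix (Fin 2) (Fin 2) ℂ) = ρ a) ∧
      ∀ (l : V) (u w : Λ → T → V),
        fderiv ℝ (fderiv ℝ (expChart ℰ ρ)) 0 u (fun ν x => eV.symm ⁅eV l, eV (w ν x)⁆) +
          fderiv ℝ (fderiv ℝ (expChart ℰ ρ)) 0 w (fun ν x => eV.symm ⁅eV l, eV (u ν x)⁆) = 0 := by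
  obtain ⟨eV, heV, hρ⟩ := exists_lieEquiv_su_of_suChart ρ hinj hmem honto
  obtain ⟨ℰ', h1, h2, h3⟩ := exists_ambient_extension ρ hinj hmem honto ℰ e
  refine ⟨eV, heV, fun l u w => ?_⟩
  have h := hessian_chart_ad_invariant_of_isSemisimple eV e ρ hρ (h2 3 hC3)
    (fun lam' => (h3 hGI lam').mono fun W hW => Filter.Eventually.of_forall fun t => hW t) l u w
  have hchart : (fun B : Λ → T → V => ℰ' (fun ν x => exp (ρ (B ν x)))) = expChart ℰ ρ := by rw [← h1]; rfl
  rw [hchart] at h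
  exact h

-- (the quadruply nested operator space over the iterated `Pi` type: one more level of pending instance synthesis)
set_option maxSynthPendingDepth 3 in
/-- **★ (4.15)₃ FOR ANY `SU(2)`-GAUGE-INVARIANT FUNCTIONAL** (`C⁴` at `0`), `k₂ = 1∕12`, brackets transported from 𝔰𝔲(2). [cite: Balaban1987RG1, (4.15) p.284, (4.12) p.284, (4.7) p.282] -/
theorem wardThird_of_suGaugeInvariant (ρ : V →L[ℝ] Matrix (Fin 2) (Fin 2) ℂ) (hinj : Function.Injective ρ)
    (hmem : ∀ x, (ρ x)ᴴ = -ρ x ∧ (ρ x).trace = 0) (honto : ∀ X : Matrix (Fin 2) (Fin 2) ℂ, Xᴴ = -X → X.trace = 0 → ∃ x, ρ x = X)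
    (ℰ : (Λ → T → Matrix (Fin 2) (Fin 2) ℂ) → F) (e : Λ → T) (hC4 : ContDiffAt ℝ 4 (expChart ℰ ρ) 0)
    (hGI : ∀ᶠ Vf in 𝓝 (1 : Λ → T → Matrix (Fin 2) (Fin 2) ℂ), (∀ ν x, Vf ν x ∈ Matrix.specialUnitaryGroup (Fin 2) ℂ) →
      ∀ g : T → Matrix (Fin 2) (Fin 2) ℂ, (∀ x, g x ∈ Matrix.specialUnitaryGroup (Fin 2) ℂ) → ℰ (fun ν x => g x * Vf ν x * star (g (x + e ν))) = ℰ Vf) :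
    ∃ eV : V ≃ₗ[ℝ] su (Fin 2), (∀ a, ((eV a : su (Fin 2)) : Matrix (Fin 2) (Fin 2) ℂ) = ρ a) ∧
      ∀ (u₁ u₂ u₃ : Λ → T → V) (lam : T → V),
        fderiv ℝ (fderiv ℝ (fderiv ℝ (fderiv ℝ (expChart ℰ ρ)))) 0 u₁ u₂ u₃ (fun ν y => lam (y + e ν) - lam y)
          - fderiv ℝ (fderiv ℝ (fderiv ℝ (expChart ℰ ρ))) 0 u₁ u₂
              (fun ν x => eV.symm ⁅eV (lam x), eV (u₃ ν x)⁆ - (2 : ℝ)⁻¹ • eV.symm ⁅eV (u₃ ν x), eV (lam (x + e ν) - lam x)⁆)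
          - fderiv ℝ (fderiv ℝ (fderiv ℝ (expChart ℰ ρ))) 0 u₁ u₃
              (fun ν x => eV.symm ⁅eV (lam x), eV (u₂ ν x)⁆ - (2 : ℝ)⁻¹ • eV.symm ⁅eV (u₂ ν x), eV (lam (x + e ν) - lam x)⁆)
          - fderiv ℝ (fderiv ℝ (fderiv ℝ (expChart ℰ ρ))) 0 u₂ u₃
              (fun ν x => eV.symm ⁅eV (lam x), eV (u₁ ν x)⁆ - (2 : ℝ)⁻¹ • eV.symm ⁅eV (u₁ ν x), eV (lam (x + e ν) - lam x)⁆)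
          + fderiv ℝ (fderiv ℝ (expChart ℰ ρ)) 0 u₁
              (fun ν x => (12 : ℝ)⁻¹ • (eV.symm ⁅eV (u₂ ν x), eV (eV.symm ⁅eV (u₃ ν x), eV (lam (x + e ν) - lam x)⁆)⁆ +
                eV.symm ⁅eV (u₃ ν x), eV (eV.symm ⁅eV (u₂ ν x), eV (lam (x + e ν) - lam x)⁆)⁆))
          + fderiv ℝ (fderiv ℝ (expChart ℰ ρ)) 0 u₂
              (fun ν x => (12 : ℝ)⁻¹ • (eV.symm ⁅eV (u₁ ν x), eV (eV.symm ⁅eV (u₃ ν x), eV (lam (x + e ν) - lam x)⁆)⁆ +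
                eV.symm ⁅eV (u₃ ν x), eV (eV.symm ⁅eV (u₁ ν x), eV (lam (x + e ν) - lam x)⁆)⁆))
          + fderiv ℝ (fderiv ℝ (expChart ℰ ρ)) 0 u₃
              (fun ν x => (12 : ℝ)⁻¹ • (eV.symm ⁅eV (u₁ ν x), eV (eV.symm ⁅eV (u₂ ν x), eV (lam (x + e ν) - lam x)⁆)⁆ +
                eV.symm ⁅eV (u₂ ν x), eV (eV.symm ⁅eV (u₁ ν x), eV (lam (x + e ν) - lam x)⁆)⁆)) = 0 := by
  obtain ⟨eV, heV, hρ⟩ := exists_lieEquiv_su_of_suChart ρ hinj hmem honto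
  obtain ⟨ℰ', h1, h2, h3⟩ := exists_ambient_extension ρ hinj hmem honto ℰ e
  refine ⟨eV, heV, fun u₁ u₂ u₃ lam => ?_⟩
  have h := fourth_chart_apply_grad_eq_zero_of_bracket e ρ (h2 4 hC4) lam
    ((h3 hGI lam).mono fun W hW => Filter.Eventually.of_forall fun t => hW t) (fun a b => eV.symm ⁅eV a, eV b⁆) hρ u₁ u₂ u₃
  have hchart : (fun B : Λ → T → V => ℰ' (fun ν x => exp (ρ (B ν x)))) = expChart ℰ ρ := by rw [← h1]; rfl
  rw [hchart] at h
  exact h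

-- (the quadruply nested operator space over the iterated `Pi` type: one more level of pending instance synthesis)
set_option maxSynthPendingDepth 3 in
/-- **★★ (4.29) EXACT FOR ANY `SU(2)`-GAUGE-INVARIANT FUNCTIONAL** (`C⁴` at `0`), POINTWISE in the distinguished site `x` (`δB` one-site, `λ_x(x) = 0`, `c = ∂λ_x`, `B(x) = c(x)`), the eleven
«irrelevant terms» of `B12WTReduction429.eq429` explicit (each carries a factor `B − c`; NOT bounded). [cite: Balaban1987RG1, (4.21) p.285, (4.23) p.286, (4.24)-(4.27) p.287, (4.28)-(4.29) p.288] -/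
theorem eq429_of_suGaugeInvariant (ρ : V →L[ℝ] Matrix (Fin 2) (Fin 2) ℂ) (hinj : Function.Injective ρ)
    (hmem : ∀ x, (ρ x)ᴴ = -ρ x ∧ (ρ x).trace = 0) (honto : ∀ X : Matrix (Fin 2) (Fin 2) ℂ, Xᴴ = -X → X.trace = 0 → ∃ x, ρ x = X)
    (ℰ : (Λ → T → Matrix (Fin 2) (Fin 2) ℂ) → F) (e : Λ → T) (hC4 : ContDiffAt ℝ 4 (expChart ℰ ρ) 0)
    (hGI : ∀ᶠ Vf in 𝓝 (1 : Λ → T → Matrix (Fin 2) (Fin 2) ℂ), (∀ ν x, Vf ν x ∈ Matrix.specialUnitaryGroup (Fin 2) ℂ) →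
      ∀ g : T → Matrix (Fin 2) (Fin 2) ℂ, (∀ x, g x ∈ Matrix.specialUnitaryGroup (Fin 2) ℂ) → ℰ (fun ν x => g x * Vf ν x * star (g (x + e ν))) = ℰ Vf) :
    ∃ eV : V ≃ₗ[ℝ] su (Fin 2), (∀ a, ((eV a : su (Fin 2)) : Matrix (Fin 2) (Fin 2) ℂ) = ρ a) ∧
      ∀ (x : T) (lam : T → V), lam x = 0 → ∀ (δ c B : Λ → T → V),
        (∀ ν y, y ≠ x → δ ν y = 0) → (∀ ν y, lam (y + e ν) - lam y = c ν y) → (∀ ν, B ν x = c ν x) →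
        fderiv ℝ (fderiv ℝ (fderiv ℝ (fderiv ℝ (expChart ℰ ρ)))) 0 δ B B B =
          (2 : ℝ) • fderiv ℝ (fderiv ℝ (expChart ℰ ρ)) 0 δ (fun ν y => eV.symm ⁅eV (lam y), eV (eV.symm ⁅eV (lam y), eV (c ν y)⁆)⁆)
          - fderiv ℝ (fderiv ℝ (expChart ℰ ρ)) 0 δ (fun ν y => eV.symm ⁅eV (eV.symm ⁅eV (lam y), eV (c ν y)⁆), eV (c ν y)⁆)
          - (3 / 2 : ℝ) • fderiv ℝ (fderiv ℝ (expChart ℰ ρ)) 0 (fun ν y => eV.symm ⁅eV (δ ν y), eV (B ν y)⁆) (fun ν y => eV.symm ⁅eV (lam y), eV (c ν y)⁆)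
          + (fderiv ℝ (fderiv ℝ (fderiv ℝ (fderiv ℝ (expChart ℰ ρ)))) 0 δ B B (B - c)
            - (2 : ℝ) • fderiv ℝ (fderiv ℝ (expChart ℰ ρ)) 0
                (fun ν y => (12 : ℝ)⁻¹ • (eV.symm ⁅eV (B ν y), eV (eV.symm ⁅eV (δ ν y), eV (c ν y)⁆)⁆ + eV.symm ⁅eV (δ ν y), eV (eV.symm ⁅eV (B ν y), eV (c ν y)⁆)⁆)) (B - c)
            - (2 : ℝ) • fderiv ℝ (fderiv ℝ (expChart ℰ ρ)) 0 δ (fun ν y => (12 : ℝ)⁻¹ • eV.symm ⁅eV (B ν y), eV (eV.symm ⁅eV (B ν y - c ν y), eV (c ν y)⁆)⁆)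
            - (2 : ℝ)⁻¹ • fderiv ℝ (fderiv ℝ (fderiv ℝ (expChart ℰ ρ))) 0 (fun ν y => eV.symm ⁅eV (δ ν y), eV (B ν y)⁆) B (B - c)
            + (4 : ℝ)⁻¹ • fderiv ℝ (fderiv ℝ (expChart ℰ ρ)) 0 (fun ν y => eV.symm ⁅eV (δ ν y), eV (B ν y)⁆) (fun ν y => eV.symm ⁅eV (B ν y - c ν y), eV (c ν y)⁆)
            + (4 : ℝ)⁻¹ • fderiv ℝ (fderiv ℝ (expChart ℰ ρ)) 0 (fun ν y => eV.symm ⁅eV (eV.symm ⁅eV (δ ν y), eV (B ν y)⁆), eV (B ν y)⁆) (B - c)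
            - fderiv ℝ (fderiv ℝ (fderiv ℝ (expChart ℰ ρ))) 0 δ B (fun ν y => eV.symm ⁅eV (B ν y - c ν y), eV (c ν y)⁆)
            + (2 : ℝ) • fderiv ℝ (fderiv ℝ (fderiv ℝ (expChart ℰ ρ))) 0 δ (fun ν y => eV.symm ⁅eV (lam y), eV (B ν y)⁆) (B - c)
            + (2 : ℝ) • fderiv ℝ (fderiv ℝ (expChart ℰ ρ)) 0 δ (fun ν y => eV.symm ⁅eV (lam y), eV (eV.symm ⁅eV (lam y), eV (B ν y - c ν y)⁆)⁆)
            - fderiv ℝ (fderiv ℝ (expChart ℰ ρ)) 0 δ (fun ν y => eV.symm ⁅eV (eV.symm ⁅eV (lam y), eV (B ν y - c ν y)⁆), eV (c ν y)⁆)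
            - (3 / 2 : ℝ) • fderiv ℝ (fderiv ℝ (expChart ℰ ρ)) 0 (fun ν y => eV.symm ⁅eV (δ ν y), eV (B ν y)⁆) (fun ν y => eV.symm ⁅eV (lam y), eV (B ν y - c ν y)⁆)) := by
  obtain ⟨eV, heV, hρ⟩ := exists_lieEquiv_su_of_suChart ρ hinj hmem honto
  obtain ⟨ℰ', h1, h2, h3⟩ := exists_ambient_extension ρ hinj hmem honto ℰ e
  refine ⟨eV, heV, fun x lam hlam δ c B hδ hc hB => ?_⟩
  have h := eq429_chart_of_isSemisimple eV e ρ hρ (h2 4 hC4)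
    (fun lam' => (h3 hGI lam').mono fun W hW => Filter.Eventually.of_forall fun t => hW t) x lam hlam δ c B hδ hc hB
  have hchart : (fun B : Λ → T → V => ℰ' (fun ν x => exp (ρ (B ν x)))) = expChart ℰ ρ := by rw [← h1]; rfl
  rw [hchart] at h
  exact h

/-- **★★ (4.31) EXACT FOR ANY `SU(2)`-GAUGE-INVARIANT FUNCTIONAL** (`C³` at `0`): pointwise in `x`, `ℓ` = print's `B(·, x)` (arbitrary), the six «irrelevant terms» of `B12WTReduction429.eq431`
explicit. [cite: Balaban1987RG1, (4.30) p.288, (4.31) p.289] -/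
theorem eq431_of_suGaugeInvariant (ρ : V →L[ℝ] Matrix (Fin 2) (Fin 2) ℂ) (hinj : Function.Injective ρ)
    (hmem : ∀ x, (ρ x)ᴴ = -ρ x ∧ (ρ x).trace = 0) (honto : ∀ X : Matrix (Fin 2) (Fin 2) ℂ, Xᴴ = -X → X.trace = 0 → ∃ x, ρ x = X)
    (ℰ : (Λ → T → Matrix (Fin 2) (Fin 2) ℂ) → F) (e : Λ → T) (hC3 : ContDiffAt ℝ 3 (expChart ℰ ρ) 0)
    (hGI : ∀ᶠ Vf in 𝓝 (1 : Λ → T → Matrix (Fin 2) (Fin 2) ℂ), (∀ ν x, Vf ν x ∈ Matrix.specialUnitaryGroup (Fin 2) ℂ) →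
      ∀ g : T → Matrix (Fin 2) (Fin 2) ℂ, (∀ x, g x ∈ Matrix.specialUnitaryGroup (Fin 2) ℂ) → ℰ (fun ν x => g x * Vf ν x * star (g (x + e ν))) = ℰ Vf) :
    ∃ eV : V ≃ₗ[ℝ] su (Fin 2), (∀ a, ((eV a : su (Fin 2)) : Matrix (Fin 2) (Fin 2) ℂ) = ρ a) ∧
      ∀ (x : T) (lam : T → V), lam x = 0 → ∀ (δ c B ℓ : Λ → T → V),
        (∀ ν y, y ≠ x → δ ν y = 0) → (∀ ν y, lam (y + e ν) - lam y = c ν y) → (∀ ν, B ν x = c ν x) →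
        fderiv ℝ (fderiv ℝ (fderiv ℝ (expChart ℰ ρ))) 0 δ B B =
          fderiv ℝ (fderiv ℝ (expChart ℰ ρ)) 0 δ (fun ν y => eV.symm ⁅eV (lam y), eV (c ν y)⁆)
          + (2 : ℝ) • fderiv ℝ (fderiv ℝ (expChart ℰ ρ)) 0 δ (fun ν y => eV.symm ⁅eV (lam y), eV (ℓ ν y)⁆)
          - fderiv ℝ (fderiv ℝ (expChart ℰ ρ)) 0 δ (fun ν y => eV.symm ⁅eV (ℓ ν y), eV (c ν y)⁆)
          - fderiv ℝ (fderiv ℝ (expChart ℰ ρ)) 0 (fun ν y => eV.symm ⁅eV (δ ν y), eV (B ν y)⁆) ℓ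
          + (fderiv ℝ (fderiv ℝ (fderiv ℝ (expChart ℰ ρ))) 0 δ B (B - c - ℓ)
            + fderiv ℝ (fderiv ℝ (fderiv ℝ (expChart ℰ ρ))) 0 δ ℓ ℓ
            + fderiv ℝ (fderiv ℝ (fderiv ℝ (expChart ℰ ρ))) 0 δ (B - c - ℓ) ℓ
            - (2 : ℝ)⁻¹ • fderiv ℝ (fderiv ℝ (expChart ℰ ρ)) 0 (fun ν y => eV.symm ⁅eV (δ ν y), eV (B ν y)⁆) (B - c - ℓ)
            + fderiv ℝ (fderiv ℝ (expChart ℰ ρ)) 0 δ (fun ν y => eV.symm ⁅eV (lam y), eV (B ν y - c ν y - ℓ ν y)⁆)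
            - (2 : ℝ)⁻¹ • fderiv ℝ (fderiv ℝ (expChart ℰ ρ)) 0 δ (fun ν y => eV.symm ⁅eV (B ν y - c ν y - ℓ ν y), eV (c ν y)⁆)) := by
  obtain ⟨eV, heV, hρ⟩ := exists_lieEquiv_su_of_suChart ρ hinj hmem honto
  obtain ⟨ℰ', h1, h2, h3⟩ := exists_ambient_extension ρ hinj hmem honto ℰ e
  refine ⟨eV, heV, fun x lam hlam δ c B ℓ hδ hc hB => ?_⟩
  have h := eq431_chart_of_isSemisimple eV e ρ hρ (h2 3 hC3)
    (fun lam' => (h3 hGI lam').mono fun W hW => Filter.Eventually.of_forall fun t => hW t) x lam hlam δ c B ℓ hδ hc hB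
  have hchart : (fun B : Λ → T → V => ℰ' (fun ν x => exp (ρ (B ν x)))) = expChart ℰ ρ := by rw [← h1]; rfl
  rw [hchart] at h
  exact h

/-- **★ (4.32)–(4.34), THE LINEAGE'S FORM, FOR ANY `SU(2)`-GAUGE-INVARIANT FUNCTIONAL** (`C³` at `0`): the Hessian of `expChart ℰ ρ` at `0` is `Σ κ(eV u_μ(x), eV w_ν(y))·E_{μν}(x, y)` for ONE
scalar kernel `E` (κ the Killing form of 𝔰𝔲(2)). [cite: Balaban1987RG1, (4.32)-(4.34) p.289, (1.21) p.264] -/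
theorem hessian_eq_sum_scalar_kernel_of_suGaugeInvariant [DecidableEq Λ] [DecidableEq T] (ρ : V →L[ℝ] Matrix (Fin 2) (Fin 2) ℂ)
    (hinj : Function.Injective ρ) (hmem : ∀ x, (ρ x)ᴴ = -ρ x ∧ (ρ x).trace = 0)
    (honto : ∀ X : Matrix (Fin 2) (Fin 2) ℂ, Xᴴ = -X → X.trace = 0 → ∃ x, ρ x = X)
    (ℰ : (Λ → T → Matrix (Fin 2) (Fin 2) ℂ) → F) (e : Λ → T) (hC3 : ContDiffAt ℝ 3 (expChart ℰ ρ) 0)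
    (hGI : ∀ᶠ Vf in 𝓝 (1 : Λ → T → Matrix (Fin 2) (Fin 2) ℂ), (∀ ν x, Vf ν x ∈ Matrix.specialUnitaryGroup (Fin 2) ℂ) →
      ∀ g : T → Matrix (Fin 2) (Fin 2) ℂ, (∀ x, g x ∈ Matrix.specialUnitaryGroup (Fin 2) ℂ) → ℰ (fun ν x => g x * Vf ν x * star (g (x + e ν))) = ℰ Vf) :
    ∃ eV : V ≃ₗ[ℝ] su (Fin 2), (∀ a, ((eV a : su (Fin 2)) : Matrix (Fin 2) (Fin 2) ℂ) = ρ a) ∧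
      ∃ E : Λ → T → Λ → T → F, ∀ u w : Λ → T → V,
        fderiv ℝ (fderiv ℝ (expChart ℰ ρ)) 0 u w = ∑ μ, ∑ x, ∑ ν, ∑ y, killingForm ℝ (su (Fin 2)) (eV (u μ x)) (eV (w ν y)) • E μ x ν y := by
  haveI := Literature.Algebra.Lie.SpecialUnitarySimple.isSimple_su (Fin 2) (by simp)
  obtain ⟨eV, heV, hρ⟩ := exists_lieEquiv_su_of_suChart ρ hinj hmem honto
  obtain ⟨ℰ', h1, h2, h3⟩ := exists_ambient_extension ρ hinj hmem honto ℰ e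
  refine ⟨eV, heV, ?_⟩
  obtain ⟨E, hE⟩ := Literature.MathematicalPhysics.QuantumFieldTheory.Balaban1983to89.B12Schur433.hessian_chart_eq_sum_scalar_kernel_killing eV e ρ hρ (h2 3 hC3)
    (fun lam' => (h3 hGI lam').mono fun W hW => Filter.Eventually.of_forall fun t => hW t)
    (fun φ hφ => Literature.MathematicalPhysics.QuantumFieldTheory.Balaban1983to89.B12Schur433.exists_eq_smul_of_centroid_of_killing_neg
      (fun _ hx => Literature.Algebra.Lie.CompactKillingForm.killingForm_su_apply_self_neg hx) φ hφ)
  refine ⟨E, fun u w => ?_⟩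
  have hchart : (fun B : Λ → T → V => ℰ' (fun ν x => exp (ρ (B ν x)))) = expChart ℰ ρ := by rw [← h1]; rfl
  have h := hE u w
  rw [hchart] at h
  exact h

end Generic

end Summit.QuantumFields.YangMills.Theorems.BalabanUVNodesPortS1

end
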